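import Literature.MathematicalPhysics.QuantumFieldTheory.Balaban1983to89.B9BackgroundsKLevelV1
import Literature.MathematicalPhysics.QuantumFieldTheory.Balaban1983to89.B9Eq324LevelWeights

/-!
# `Balaban1983to89.B9Carve05SetupRegularityHyp` — [Balaban1985BackgroundPropagators] pp. 389–396 [PDF 1–8] (Introduction and
# Sect. A up to (3.38): the operators `Δ^η(U)`, `J`, `Q_j(U)`, `Q*aQ`, `Q′_j(U)`, `R`, `Δ′_a`, `G′`, `Δ_a`, `G`, their gauge covariance,
# and the regularity classes (3.35)–(3.38)): THE HYPOTHESIS-FORM BUNDLE OF CARVING BLOCK 05 — the printed standing hypotheses of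
# Sect. A on one background `U` and one perturbation `U′ = e^{iηA′}`, conjoined BY NAME from the tree, with the passage to the
# `B9.Backgrounds` carrier of record of the N06 ∕ K⁷ consumers (`B9BackgroundsKLevelV1.bg9K`)

statement-level skeleton of published theorems with citation tags; proofs where landed; nothing here is a claim about the Yang–Mills mass gap

SOURCE.  T. Bałaban, *Propagators for lattice gauge theories in a background field*, Commun. Math. Phys. **99** (1985) 389–434,
doi:10.1007/bf01240355 [Balaban1985BackgroundPropagators] (cell paper "B9"; held `paper:balaban1985-cmp99-background-propagators`,
journal page = PDF page + 388).  Pages 390–396 were read first-hand for this file on the page renders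
`run/shared/lean/pub/pub-balaban/b2b-balaban-ref1/pages/1985-cmp99-background-propagators/…-p002-x2.png` … `…-p008-x2.png` (the text
layer `p0001.txt`–`p0009.txt` garbles the displays; p. 389 = title, abstract and introduction, no statement).  STATUS of the source:
published, refereed.  Where print refers to «[4]» = T. Bałaban, *Propagators and renormalization transformations for lattice gauge
theories. II*, Commun. Math. Phys. **96** (1984) 223–250 [Balaban1984PropagatorsII] and «[5]» = T. Bałaban, *Averaging operations for
lattice gauge theories*, Commun. Math. Phys. **98** (1985) 17–51 [Balaban1985Averaging], the pointer is recorded, nothing of those papers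
is restated.

WHY THIS FILE (cell `lit-balaban`, P6 CARVING FAN of D-0154 (3b); seat `lit-balaban-carve-05`; block row 05 of
`run/shared/lean/pub/lit-balaban/carve/BLOCKS-01-10.md` ∕ `carve/CARVE-LIST.md`, rules `carve/CARVE-RULES.md`; KEY item
`stmt-QuantumFields-20542` (K1⁷, lane N06 [B9] of the pub-ymgap DAG), also-feeds `stmt-QuantumFields-19200` (R3; letters
`lettersAt_of_regular`)).  Block 05 is the SET-UP of [B9]: definitions of operators and the regularity classes.  At statement level this
stretch is IN THE TREE (cell SKELETON v3.367: 24 rows, 19 proved-existing, 5 proved; 5267 declarations in 801 files carry a locator in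
pp. 390–397) — so, by the fan's rule «IN TREE = CITE, NEVER RESTATE», this file (a) RESTATES NOTHING: every printed item of the block
that has a declaration is cited BY NAME below (tables §A, §B); (b) types NO new `…Printed` statement, because the block has no residual
printed statement without a declaration (§B gives the sentence-by-sentence census and the one deliberate omission); and (c) conjoins the
block's printed STANDING HYPOTHESES — the only assumptions Sect. A makes: the parameter ranges and the classes (3.35)–(3.38) of p. 396 —
BY NAME into ONE hypothesis bundle `Hyp` a node prover can take as `(h : Hyp …)`, in the concrete vocabulary of record of those classes
(`B9Eq335RegularityClasses`, itself on the exact-background lattice vocabulary `B9Eq39Adjoint` of rows B9.Eq3.1–3.12), together with the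
kernel-checked bookkeeping a consumer wants: every weaker printed standing assumption as a projection (class (3.35) alone — «For the
operators introduced until now we need only the condition (3.35)» —, class (3.37), the own-level reading of p. 397, the Sect. B literal
binders, the bond-local datum of `B9Eq336CurrentBound`), NON-VACUITY (`U ≡ 1`, `A′ = 0` is in the bundle for every admissible parameter
tuple) and NON-DEGENERACY (a letter `A′(b)` at or above the printed bound, or a value of `U` outside `G`, refutes it), and the passage
to and from the four `Prop`-fields `Reg335 ∕ Reg336 ∕ Cplx337 ∕ Cplx338` of the `B9.Backgrounds` carrier `bg9K` of a k-level member of the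
torus family of record (`B9BackgroundsKLevelV1`, the N06 definer's module) — the currency in which `B9.Thm31Printed` … `B9.Thm315Printed`
(rows B9.Thm3.1–3.15, blocks 06–10) and the DAG leaf `Dag.B9_main` quantify.  It moves no node count.

## §A  The block's SKELETON rows → the in-tree declarations this file CITES (never restates)
(module prefix `Literature.MathematicalPhysics.QuantumFieldTheory.Balaban1983to89.`; «used» = enters a declaration below by name)

| row | print (journal page) | in tree | here |
|---|---|---|---|
| B9.Eq3.1 | (3.1)–(3.2) p. 390: `A^η(U′U₀)`, `tr(U′U₀)(∂p) = tr(∂₀U′)((p)_z)U₀(∂p)`, `R(U)X = UXU⁻¹`, the letters `A′(b)` | `B9Eq39Adjoint.action`, `.plaqU`, `.R`, `.lettersA`, `.fluct` («U′ = exp iηA»), `.prodCfg` («U = U′U₀»); `B9Eq37Insertion.wil`; all-orders form `B9Eq31ActionZpow` | `fluct` used (§5) |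
| B9.Eq3.3 | (3.3) pp. 390–391: `(D^η_{U₀}A)(b) = η⁻¹(R(U₀(b))A(b₊) − A(b₋))` | `B9Eq39Adjoint.covD` (+ `covD_add` …); vector model `B9Eq33CovDerivVector` | used (via `Cplx337`) |
| B9.Eq3.4 | (3.4) + the unnumbered component display p. 391 | `B9Eq39Adjoint.curl`, `.curlη`, `.sum_lettersA`; `B9Eq34CovCurlVector` | `curlη` used (via `Cplx338`, `Reg336Cube`) |
| B9.Eq3.5 | (3.5) p. 391: `U(x,x′) = U⁻¹(x′,x)`, `A(x,x′) = −A(x′,x)` | built into `B9Eq39Adjoint.plaqU`, `.covDstar`; `B9Eq369Product.val_inv_prodCfg` | cited |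
| B9.Eq3.6 | (3.6)–(3.7) p. 391, with «Re U₀(∂p) = ½(U₀(∂p) + U₀(−∂p)), Im U₀(∂p) = (1∕2i)(U₀(∂p) − U₀(−∂p))» | `B9Eq37Insertion.reC`, `.imC`, `.eq37_summand`, `.eq37_summand_dim`, `.norm_rem_le` (PROVED) | cited |
| B9.Eq3.8 | (3.8)–(3.9) p. 392: `D*` on bond and on plaquette functions (adjointness) | `B9Eq39Adjoint.covDstar`, `.divB`, `.divP`, `.divPη`; PROVED `.sum_sum_covD_mul` ((3.8)), `.sum_curl_mul`, `.sum_posPlaq_curl_mul`, `.divP_eq_sum_of_antisymm'` ((3.9)) | `divPη` used |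
| B9.Eq3.10 | (3.10) p. 392: `Δ^η(U) = D*D + Δ′`, hermitian for `U(N)`-valued `U` | `B9Eq310Hermitian.deltaOp`, `.deltaPrimeOp` (hermiticity PROVED there); the form `B9Eq39Adjoint.deltaPrime`, `.hessPair`, `.sum_mul_divP_curl`; the reading of «Δ′ … a bounded, small operator» `B9Eq310DeltaPrime` (its smallness is (3.69) p. 404, `B9Eq369Small.eq369`, block 07) | cited |
| B9.Eq3.11 | (3.11) p. 392: `⟨A,J⟩ = Σ_b η^d tr A(b)J(b)`, `J = D*η⁻² Im ∂U` | `B9Eq39Adjoint.J`, `.bondPair`, `.bondPair_J`; `B9Eq311L2Pairing`, `B9Eq311TracePairing`; the bound on `J` from (3.36): `B9Eq336CurrentBound.norm_J_le_of_regularAt` | `RegularAt` reached (§4) |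
| B9.Eq3.12 | (3.12) p. 392: `A^η(e^{iηA}U) = A^η(U) + ⟨A,J⟩ + ½⟨A,ΔA⟩ + …` | PROVED `B9Eq39Adjoint.eq312`, `.eq312_letters`, `.norm_rem3_le`; `B9Eq31ActionZpow.eq312_zpow` | cited |
| B9.Eq3.13 | (3.13)–(3.15) pp. 392–393: the non-linear average, its linear part `Q_j(U)`, `Q_j(U) = Q(Ū^{j−1})⋯Q(Ū)Q(U)` | PROVED `B9Thm37GlueTorusCovComp.gMean_comp₃`, `.coarseMean_comp_covMean` ((3.15) with [5] p. 29); the covariant averaging letters on `ℤᵈ` `B9Eq316AveragingTransposeZd`; (3.14)'s analyticity clause: `B9Eq352Analytic` ∕ `B9Eq358Analytic` lineage (block 06) | cited |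
| B9.Eq3.16 | (3.16) p. 393: `⟨A,Q*aQA⟩ = Σ_j a Σ_{b∈Λ_j}(Lʲη)^{d−2}|(Q_j(U)A)(b)|²` | `B9Thm37GlueTorusCovLevels.levelSum`, `.levelOp`; the display with its coefficient `B9Eq324LevelWeights.form316`, `.coeff316`, `.qaq316` | cited |
| B9.Eq3.17 | (3.17) p. 393: the gauge-fixing density | `B9Eq320Gauss.density`, `.sliceInt`, `B9Eq320Z0`, `B9Eq3166.subInt` | cited |
| B9.Eq3.18 | (3.18)–(3.19) p. 393: `(Q′λ)(y) = (Q′_jλ)(y)` on `Λ_j`; `(Q′(V)λ)(y) = Σ_{x∈B(y)}L^{−d}R(V(Γ_{y,x}))λ(x)`; `Q′_j(U)` | `B9Thm311Lattice.qL`, `.IsBlockSystem`; `B9Eq319Avg.avgOp`; the tower `B9Eq315QTower` ∕ `B9Eq319QprimeTorus` lineages | cited |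
| B9.Eq3.20 | (3.20) p. 394: `(3.17) = exp(−(1∕2α)‖RD*A‖²)` | PROVED `B9Eq320Gauss.density_320`; `B9Eq325Proj.exponent_320`; `B9Eq326MultiLevelAssembly.inner_DRD` | cited |
| B9.Eq3.21 | (3.21)–(3.22) p. 394: `R` = orthogonal projection onto `Δ^η_U N(Q′)`, `N(Q′) = ker Q′`; the minimiser `λ₀` | `B9Eq325Proj.R325`, `.lapKer`, `.lam0`, `.Data`; `B9Eq326MultiLevelAssembly.Rdir`; on `ℤᵈ` `B9Eq321LandauProjectionZd` | cited |
| B9.Eq3.23 | (3.23) p. 394: `Δ^η_U = D^{η*}_U D^η_U = Σ_μ D^{η*}_{U,μ}D^η_{U,μ}`, Dirichlet conditions on `Ω₀ᶜ` | `B9Thm311Lattice.lapL`; the Dirichlet dictionary `B9Eq323DirichletSplit`; «They depend on the configuration U restricted to Ω₀» PROVED: `B9Eq322Dirichlet.comp_lapL_local`, `B9Eq323DirichletSplit.comp_lapL_local` | cited |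
| B9.Eq3.24 | (3.24) p. 394: `Δ′_a = (Δ^η_U + Q′*aQ′)↾Ω₀`, the form, «a_{j+1} = aa_j∕(aL⁻² + a_j), a₁ = a₀ = a > 0», `G′ = (Δ′_a)⁻¹` | `B9Eq325Proj.lapA`; `B9Eq325Pairing.M324`; WITH THE PRINTED WEIGHTS `B9Eq324LevelWeights.aLevel` (recursion as body, `.aLevel_succ`, `.aLevel_eq_aSeq`), `.coeff324`, `.deltaPrimeA`, `.form324`, `.exists_Gprime_324` («Its inverse is denoted by G′»: PROVED positive-definite and invertible at print's weights) | `aLevel_pos` used (§1) |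
| B9.Eq3.25 | (3.25) p. 394: `Rf = (I − G′Q′*(Q′G′²Q′*)⁻¹Q′G′)f`; p. 395 (p0007.txt:L1–4) «Δ′_a is positive … hence the existence of the operator R» | `B9Eq325Proj.R325`, `.R325_apply`; PROVED `B9Thm311Lattice.obvious_311_lattice`, `B9Thm311Data.exists_data`, `B9Eq324LevelWeights.R325_324_eq_starProjection` ((3.25) IS the projection (3.21)) | cited |
| B9.Eq3.26 | (3.26)–(3.27) p. 395: `Δ^η_a(U) = Δ^η(U) + D^η_U R(U)D^{η*}_U + Q*(U)aQ(U)`, `G(U) = (Δ_a↾Ω₀)⁻¹`; «It coincides with Δ_a in (2.19) if U = 1» | `B9Eq333Cov.lapFull`; `B9Eq386Neumann.deltaA`; `B9Eq326MultiLevelAssembly` (the multi-level assembly of (3.26)); the `U = 1` identification `B9Cor35AtOneInverseLetters` (module docstring, p. 395) | cited |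
| B9.Eq3.28 | (3.28)–(3.34) pp. 395–396: `U → U^u`, `U′ → R(u)U′`; (3.29) invariance of `A^η`; (3.30) `J^u = R(u)J`, `Δ^η(U^u) = R(u)Δ^η(U)R(u⁻¹)`; (3.31)–(3.34) covariance of `Δ^η_U`, `Q′_j`, `Q′*aQ′`, `G′`, `R`, `Δ_a`, `G` | `B9Eq3117Current.gaugeTr` ((3.28), used inside `Reg335Cube`); `B9Eq328GaugeAction`; `B9Eq330HessianCovariance`; `B9Eq331LatticeCov`; `B9Eq332AvgCovariance`, `B9Eq332FieldAvgCovariance`, `B9Eq332QprimeTowerGaugeCovariance`; `B9Eq333ProjectionCovariance`; `B9Eq334LaplaceACovariance`; the intertwining algebra `B9Eq333Cov` (`.gaugeAct`, `.lapA_intertwine`, `.g_intertwine` (3.33a), `.R_intertwine'` (3.33b), `.lapFull_intertwine` (3.34a), `.G_intertwine` (3.34b), `.kernel_bound_iff`); at the record `Node00.OpsYGauge` | `gaugeTr` used (via `Reg335Cube`) |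
| B9.Def@396 | the cube class, p. 396: «□ ⊂ Bʲ(Λ_j) ∪ B^{j+1}(Λ_{j+1}), □ ∩ Bʲ(Λ_j) ≠ ∅, □ a union of several big blocks of T_{Lʲη} … its size in T_η is O(1)MLʲη. Here O(1) will mean a number ≧ 10»; «Λ₀ = Ω₀∖Ω₁, where Ω₀ = {a union of big blocks of the lattice T₁, such that their distances to Ω₁ are ≦ RM}» (also p. 394) | `B9SectCCubes.box`, `.tilde`, `.shifts` (the cubes of Sect. C); on the torus of record `B9BackgroundsKLevelV1.IsCube396`, `.cubeClass396`, `.levV1`; the `Ω₀`-layer `B9Eq322Dirichlet` (module docstring, p. 394) | `cubeClass396`, `levV1` used (§5); here the cube class is the PARAMETER `𝒬` exactly as in `B9Eq335RegularityClasses.Reg335` |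
| B9.Eq3.35 | (3.35)–(3.36) p. 396 | `B9Eq335RegularityClasses.Reg335Cube`, `.Reg336Cube`, `.Reg335`, `.Reg336`, `.Reg336.reg335` («later on we will have to assume (3.36) also»), `.regularAt_of_reg336Cube`; abstract faces `B9.Backgrounds.Reg335 ∕ .Reg336` (`B9`), bodies on the torus of record `B9BackgroundsKLevelV1.Reg335Body ∕ .Reg336Body`, `.reg336Cube_one` | USED: fields `Hyp.reg336`, projections §4, non-vacuity §5 |
| B9.Eq3.37 | (3.37)–(3.38) p. 396 | `B9Eq335RegularityClasses.Cplx337`, `.Cplx338`, `.Cplx337Own`, `.Cplx338Own`, `.cplx337_iff_own`, `.cplx338_iff_own` (the p. 397 remark), `.cplx337_zero`, `.Cplx337.mono`, `.Cplx337.binders`, `.isOpen_cplx337`; abstract faces `B9.Backgrounds.Cplx337 ∕ .Cplx338`, bodies `B9BackgroundsKLevelV1.Cplx337Body ∕ .Cplx338Body`; the analytic domain `B9Eq373V3Analytic.dom337` | USED: field `Hyp.cplx338`, projections §4 |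
| B9.Eq3.16-2.4 | (3.16)–(3.19) with [5] (2.4): covariant block averaging of Lie-algebra fields in a background | Summits-side `SubstrateCovariantAveraging.QcovOf` (NOT importable into `Literature/`); Literature models: `B9Thm37GlueTorusCovComp` (above), `B9Eq316AveragingTransposeZd` (the letters `Q`, `Q*` on `ℤᵈ`), `B9Eq319Avg` | cited |

## §B  Census of the REMAINING printed sentences of pp. 390–396 that assert or define something, with disposition
(locators `pNNNN.txt:L<n>` = line n of the held text layer of PDF page NNNN = journal page − 388, the check referees' convention; every
quote was read on the page render, the text layer garbling the formulas; nothing below is typed anew — each item is in the tree or is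
deliberately not typed, as said)

* p. 390 (p0002.txt:L10–12) «in this paper a norm |X| of a N × N matrix means the Hilbert–Schmidt norm: |X|² = tr X*X» — a CONVENTION; recorded as
  cell divergence D-r1.1 in `B9` (module docstring) and in `B9Eq333Cov` §4 (`norm_kerConj`: the bounds are unitarily invariant in either
  norm); the lattice vocabulary used here (`B9Eq39Adjoint`, `B9Eq335RegularityClasses`) works in the norm of an abstract complete normed
  ℂ-algebra `𝔸` — print's `|·|` is ONE instance; nothing to type.
* p. 390 (p0002.txt:L16–18) «we assume only that ηA is in a sufficiently small neighbourhood of 0 in the Lie algebra 𝔤» — the standing smallness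
  making the expansions (3.2), (3.6), (3.7), (3.12) converge: in the tree the expansions are IDENTITIES with explicit remainders valid
  for all `A` (`B9Eq37Insertion.norm_rem_le`, `B9Eq39Adjoint.norm_rem3_le`), so no hypothesis is needed; cited.
* p. 391 (p0003.txt:L21–23) «This expansion is valid also for configurations A and U₀ with values respectively in the complexified algebra 𝔤ᶜ and
  the group Gᶜ» (with the complexified `Re`, `Im`) — `B9Eq37Insertion.reC ∕ imC` and the whole `B9Eq39Adjoint` assembly are over
  arbitrary units of `𝔸` (no unitarity): cited.  p. 393 (p0005.txt:L10–11) «These definitions extend straightforwardly to configurations U, A with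
  values in the complexified group Gᶜ and algebra 𝔤ᶜ, see Sect. E in [5]» — likewise (the averaging letters of `B9Thm37GlueTorusCovComp`,
  `B9Eq316AveragingTransposeZd` take arbitrary unit-valued transports).
* p. 392 (p0004.txt:L1–2) «the trace is normalized, i.e., tr 1 = 1» — convention; the pairings of record carry an abstract tracial functional `τ`
  (`B9Eq39Adjoint.bondPair`, `B9Eq311TracePairing`): nothing to type.
* p. 392 (p0004.txt:L22–24, after (3.10)) «with our assumptions on the configuration U the operator Δ′ will be a bounded, small operator, which will be
  treated as a small perturbation of D*D» — an announcement of (3.69) p. 404 (block 07, PROVED `B9Eq369Small.eq369`; reading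
  `B9Eq310DeltaPrime`): cited, not a hypothesis of Sect. A.
* p. 393 (p0005.txt:L12–19) «We refer the reader to the beginning of Sect. A of [4], especially to (2.1)–(2.4). The only change we make is that the
  sequence (2.1) starts with Ω₀, thus we have Ω₀ ⊃ Ω₁ ⊃ ⋯ ⊃ Ω_k, Ω_j ⊂ T_η, and we define Λ_j = Ω_j^{(j)}∖Ω_{j+1}^{(j)}, j = 0, 1, …, k,
  Ω_{k+1} = ∅ … The condition (2.2) is unchanged.» — the GEOMETRIC SETTING, by reference to [4]: in the tree `B6.Geometry` (abstract; its field `Hyp21_22`) ∕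
  `B9.Geometry`, `B6MultiLevelTorusOperator.TDomains` (the nested domain sequences of the torus family of record),
  `B9Eq335RegularityClasses.OnOmega` («on Ω_j» through a level function) — here the PARAMETERS `lev` (level function) and `𝒬` (cube
  class), instantiated in §5 at a member of record by `B9BackgroundsKLevelV1.levV1 ∕ .cubeClass396`; nothing of [4] is restated.
* p. 394 (p0006.txt:L1–2) «Q′_j(U) are linear parts of the averaging operations R̄uʲ for gauge transformations u = e^{iλ}, operations defined by
  (78)–(80) in [5]» — provenance sentence (pointer to [5]); the linear operators themselves are row B9.Eq3.18: cited.
* p. 394 (p0006.txt:L19–20) «the numbers a_j satisfy the recursive equations a_{j+1} = aa_j∕(aL⁻² + a_j), a₁ = a₀ = a > 0» — IN TREE WITH BODY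
  `B9Eq324LevelWeights.aLevel` (row B9.Eq3.24); the clause «a > 0» is the field `ParamsPrinted.a_pos` of the bundle and
  `ParamsPrinted.aLevel_pos` carries it to every `a_j` BY NAME (`B9Eq324LevelWeights.aLevel_pos`).
* p. 394 (p0006.txt:L21–35: Dirichlet conditions, the choice of `Ω₀`, «They depend on the configuration U restricted to Ω₀ … All operators we will
  consider will be defined by using Dirichlet boundary conditions on Ω₀») — PROVED `B9Eq322Dirichlet.comp_lapL_local`,
  `B9Eq323DirichletSplit.comp_lapL_local` (locality), `B9Eq322Dirichlet` (the `Ω₀`-layer reading); cited.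
* p. 395 (p0007.txt:L1–4) «Assuming some regularity of the configuration U it can be easily shown that the operator Δ′_a is positive. This implies
  positivity of the operators G′, Q′G′²Q′*, hence the existence of the operator R.» — PROVED on the finite lattice carrier WITHOUT the
  regularity proviso (`B9Eq324LevelWeights.exists_Gprime_324`, `B9Thm311Lattice.obvious_311_lattice`, `B9Thm311Data.exists_data`); the
  quantitative positivity is Theorem 3.11 p. 416 (`B9.Thm311Printed`, block 09): cited.
* p. 395 (p0007.txt:L8) «It coincides with Δ_a in (2.19) if U = 1» — `B9Cor35AtOneInverseLetters` (the `U = 1` identification of the direct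
  operators), Corollary 3.5 p. 407 (`B9.Cor35Printed`, block 07): cited.
* p. 395 (p0007.txt:L27–28) «Of course R(u(x)) exp iηA(x,x′) = exp iηR(u(x))A(x,x′) and R(u)A is linear in A» — `B12Membership314.exp_units_conj'`
  (used by `B9Eq39Adjoint.wil_plaqU_prodCfg`), `B9Eq39Adjoint.R_add ∕ R_smul`: cited.
* p. 396 (p0008.txt:L25–26) «The number α₀ characterizes this class of configurations. We will need α₀ so small that O(1)Mα₀ is still a
  sufficiently small number.» — the informal announcement of the thresholds «Mα₀ ≦ a₀» of Theorems 3.1–3.15 (the `∃ a₀` of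
  `B9.Thm31Printed` …, blocks 06–10); NOT a hypothesis of Sect. A's set-up and not typed here (no threshold is printed on p. 396).
* p. 396 (p0008.txt:L26–27) «these regularity conditions do not impose any constraints on U outside the domain Ω₀» — a property of the
  DEFINITION (the cubes lie in `⋃_j Bʲ(Λ_j) ⊂ Ω₀`): for the bundle below it is the fact that `Hyp.reg336` only speaks about the cubes
  of `𝒬`; on the tori of record `Ω₀ = T_η` and the remark is void (`B9BackgroundsKLevelV1`, module docstring (c)); nothing to type.
* p. 396 (p0008.txt:L27–29) «For the operators introduced until now we need only the condition (3.35), but later on we will have to assume (3.36)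
  also.» — PROVED as the inclusion `B9Eq335RegularityClasses.Reg336.reg335`; here `Hyp.reg335` (§4).
* p. 396 (p0008.txt:L31–32) «We may define regularity conditions for such [Gᶜ-valued] configurations in the same way, i.e. by the conditions
  (3.35), (3.36). Instead we specify somewhat more the class …» — an option print does NOT take; nothing to type.
* p. 396–397 (p0008.txt:L40 – p0009.txt:L1–2) «We will prove in another paper that if U′U satisfies the conditions (3.37), (3.38), then it satisfies
  also (3.35), (3.36) with α₀ replaced by O(1)(α₀ + α₁), but we will not use this fact here.» — a claim whose proof the author DEFERS to
  another paper and which [B9] does not use: DELIBERATELY NOT TYPED (not a result proved in this source; a Literature statement must cite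
  a source that proves it; the same decision is recorded in `B9Eq369Product`, module docstring, and by block 06's file; an ANALOGUE for
  plaquette-variable tube conditions is PROVED in `B10Eq28CplxRegTube.norm_plaqInv_sub_one_le_of_mem_regTube`).  It is in particular NOT
  a conjunct of `Hyp`.
LOCATED for the record (not this file's to repair; reported on the cell's STATUS): `B9BackgroundsKLevelV1.IsCube396` bounds the cube's
size factor by `n ≤ 10` and its module docstring quotes p. 396 as «a number ≤ 10», whereas the render of p. 396 (`…-p008-x2.png`; text layer p0008.txt:L13 «a number ^ 10») prints «Here
O(1) will mean a number ≧ 10» (so read also by SKELETON row B9.Def@396 and by `B9.Backgrounds`' docstring; p. 409, p0021.txt:L1–2: «the number O(1) in the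
condition (3.35) can be taken as equal to 12»).  The bundle below is
agnostic: the cube class `𝒬` is a parameter, and the factor enters only through the one constant `c` with the printed range `10 ≤ c`.

## §C  What is here
* §1 `ParamsPrinted η L M c α₀ α₁ a` — the printed RANGES of the Sect. A parameters, one field each, with the kernel-checked consequences a
  consumer needs (`const_pos`: `0 < c·M·α₀`; `scaleLen_pos`; `aLevel_pos`, `aLevel_le` BY NAME from `B9Eq324LevelWeights`).
* §2 `Class337`, `Class338` — print's two COMPOSITE classes of p. 396 («U has values in G», «U satisfies the condition (3.35), and …
  (3.37)»; «U satisfies (3.35), (3.36), A′ satisfies (3.37) and … (3.38)») as conjunctions BY NAME of `B9Eq335RegularityClasses.Reg335 ∕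
  Reg336 ∕ Cplx337 ∕ Cplx338` and the `G`-valuedness clause (the gauge group `G : Subgroup 𝔸ˣ` a parameter; `G = ⊤` recovers the bare
  classes); `Class338.class337`; the zero perturbation `class337_zero ∕ class338_zero` («U′ = 1» is in the class over any regular `U`).
* §3 `Hyp` — THE BUNDLE OF BLOCK 05: `ParamsPrinted` ∧ class (3.38) (the strongest printed standing class; every weaker one by projection).
* §4 bookkeeping out of `Hyp` (no statement of the paper asserted): `reg335`, `reg336`, `cplx337`, `cplx338`, `class337`, `class338`,
  `reg335Cube ∕ reg336Cube` (per cube of `𝒬`), `cplx337Own ∕ cplx338Own` (p. 397 remark, by `cplx337_iff_own`), the strict printed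
  letters `norm_letter_lt ∕ norm_covD_lt ∕ norm_divD_lt`, the Sect. B literal binders `binders`, the bond-local datum `regularAt`
  (`B9Eq336CurrentBound.RegularAt`, by `regularAt_of_reg336Cube`), monotonicity in `α₁` (`Hyp.mono_alpha1`).
* §5 NON-VACUITY `hyp_one_zero` (for `[NormOneClass 𝔸]`: `U ≡ 1`, `A′ = 0` satisfy `Hyp` for every `ParamsPrinted` tuple, any `𝒬`, `lev`;
  BY NAME from `B9BackgroundsKLevelV1.reg336Cube_one`, `B9Eq335RegularityClasses.cplx337_zero`), NON-DEGENERACY `not_hyp_of_le_norm_letter`,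
  `not_hyp_of_not_mem`; and THE PASSAGE TO THE CARRIER OF RECORD: at a k-level member `i` (`B6KLevelCensusIndexV1.KIdx`) with its torus
  shifts, `η`, `L`, `M`, cube class and level function, `HypAt i U c α₀ α₁ a A′` gives the four fields `(bg9K 𝔸 G i).Reg335 c α₀ U`,
  `.Reg336 c α₀ U`, `.Cplx337 α₁ U (e^{iηA′})`, `.Cplx338 α₁ U (e^{iηA′})` (`HypAt.bg9K_reg335` … `.bg9K_cplx338`), and conversely the two
  strongest fields with the printed parameter ranges give `HypAt` for some `A′` with `U′ = e^{iηA′}` (`hypAt_of_bg9K`); the member's own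
  `η > 0`, `L > 1`, `M > 0` are theorems (`member_eta_pos_one_lt_L_M_pos`).

## HONEST SCOPE — what is NOT claimed
Nothing of [B9] is proved here and no statement of the paper is asserted: `Hyp`, `Class337`, `Class338`, `ParamsPrinted` are HYPOTHESIS
bundles over explicit carriers; §4–§5 are bookkeeping between typed shapes and two sanity facts.  Carrier = the exact-background lattice
vocabulary of `B9Eq39Adjoint` ∕ `B9Eq335RegularityClasses` (sites `S`, directions `ι`, bijective shifts `T`, bond variables in the units
of a complete normed ℂ-algebra `𝔸` ⊇ print's `G ⊂ U(N) ⊂ M_N(ℂ)`); «A′ ∈ 𝔤ᶜ» is not modelled beyond `𝔸`-valuedness and the norm is `𝔸`'s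
(cell divergence D-r1.1); print's per-cube factor «O(1)» («where O(1)M is a size of □») is ONE constant `c ≥ 10` for all cubes, as in
`B9.Backgrounds.Reg335 c35`, `B9Eq335RegularityClasses.Reg335 … C` and `bg9K` (located reading (c) of `B9BackgroundsKLevelV1`); the cube
class and the domain sequence are parameters (`𝒬`, `lev`), bound in §5 to the member of record; the ranges `0 < η`, `1 < L`, `0 < M` are the
geometric setting's ([4] (2.1)–(2.4), by reference on p. 393) and are theorems at every member of record.  The operators of Sect. A are
DEFINED in the cited modules and are not parameters of `Hyp` (Sect. A assumes nothing about them).  No summit statement is proved by this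
file; it moves no node count; nothing continuum ∕ ℝ⁴ ∕ OS ∕ mass-gap ∕ Clay.  No `sorry`, no `instance`, no `notation`, no attribute
manipulation.
-/

namespace Literature.MathematicalPhysics.QuantumFieldTheory.Balaban1983to89.B9Carve05SetupRegularityHyp

open Literature.MathematicalPhysics.QuantumFieldTheory.Balaban1983to89.B9Eq335RegularityClasses
  (OnOmega Reg335 Reg336 Reg335Cube Reg336Cube Cplx337 Cplx338 Cplx337Own Cplx338Own)
open Literature.MathematicalPhysics.QuantumFieldTheory.Balaban1983to89.B9Eq39Adjoint (covD curlη divPη fluct)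
open Literature.MathematicalPhysics.QuantumFieldTheory.Balaban1983to89.B9Eq336CurrentBound (RegularAt)
open Literature.MathematicalPhysics.QuantumFieldTheory.Balaban1983to89.LatticeNorms (scaleLen)

/-! ## §1  The printed ranges of the Sect. A parameters -/

/-- **The printed RANGES of the parameters of Sect. A** (pp. 393–396), one field each: the lattice spacing `η > 0` and the block size
`L > 1`, big-block size `M > 0` of the geometric setting (p. 393, p0005.txt:L12–19, by reference: *«We refer the reader to the beginning
of Sect. A of [4], especially to (2.1)–(2.4) … Ω_j ⊂ T_η … Λ_j ⊂ T^{(j)}_{Lʲη}»*; [4] p. 224 (2.2) *«M is a size of big blocks and R is a big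
positive integer»*; p. 394 *«big blocks of the lattice T₁»*, p. 396 *«O(1)MLʲη»*; `η = L^{−k}` the spacing of `T_η` and `L` the integer
scale factor of the lattices `T^{(j)}_{Lʲη}` — their ranges `η > 0`, `L > 1` are the standing convention of the series, not re-derived
here, and theorems at every member of record, §5); the cube size factor *«Here O(1) will mean a number ≧ 10»* (p. 396, p0008.txt:L13) —
ONE constant `c` for all cubes, as in `B9.Backgrounds.Reg335 c35` and `B9Eq335RegularityClasses.Reg335 … C`; *«For a given positive
number α₀»* (p. 396, p0008.txt:L15); *«For a given pair of positive numbers α₀, α₁»* (p. 396, p0008.txt:L34–35); *«a₁ = a₀ = a > 0»* (p. 394,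
p0006.txt:L19–20, after (3.24)).  Hypothesis-form; nothing is asserted.
[cite: Balaban1985BackgroundPropagators, (3.24) p.394 + (3.35)–(3.38) p.396; Balaban1984PropagatorsII, (2.1)–(2.4) p.224] -/
structure ParamsPrinted (η L M c α₀ α₁ a : ℝ) : Prop where
  /-- the lattice spacing `η` of `T_η` is positive (p. 390; [4] (2.1)). [cite: Balaban1985BackgroundPropagators, p.390; Balaban1984PropagatorsII, (2.1) p.224] -/
  eta_pos : 0 < η
  /-- the block size `L` of the lattices `T^{(j)}_{Lʲη}` exceeds `1` ([4] (2.1), by reference p. 393). [cite: Balaban1985BackgroundPropagators, p.393; Balaban1984PropagatorsII, (2.1) p.224] -/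
  one_lt_L : 1 < L
  /-- the big-block size `M` is positive (p. 394 «big blocks», p. 396 «O(1)MLʲη»; [4] (2.2)). [cite: Balaban1985BackgroundPropagators, p.396; Balaban1984PropagatorsII, (2.2) p.224] -/
  M_pos : 0 < M
  /-- «Here O(1) will mean a number ≧ 10» (p. 396, p0008.txt:L13). [cite: Balaban1985BackgroundPropagators, p.396] -/
  ten_le_c : 10 ≤ c
  /-- «For a given positive number α₀» (p. 396, p0008.txt:L15). [cite: Balaban1985BackgroundPropagators, (3.35) p.396] -/
  alpha0_pos : 0 < α₀
  /-- «For a given pair of positive numbers α₀, α₁» (p. 396, p0008.txt:L34–35). [cite: Balaban1985BackgroundPropagators, (3.37) p.396] -/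
  alpha1_pos : 0 < α₁
  /-- «a₁ = a₀ = a > 0» (p. 394, p0006.txt:L19–20, after (3.24)). [cite: Balaban1985BackgroundPropagators, (3.24) p.394] -/
  a_pos : 0 < a

namespace ParamsPrinted

variable {η L M c α₀ α₁ a : ℝ}

/-- `L ≥ 1` (the form the `B9Eq335RegularityClasses` lemmas take). [cite: Balaban1984PropagatorsII, (2.1) p.224 (bookkeeping)] -/
theorem one_le_L (h : ParamsPrinted η L M c α₀ α₁ a) : 1 ≤ L := h.one_lt_L.le

/-- the cube size factor is positive: `0 < c` (from `10 ≤ c`). [cite: Balaban1985BackgroundPropagators, p.396 (bookkeeping)] -/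
theorem c_pos (h : ParamsPrinted η L M c α₀ α₁ a) : 0 < c := lt_of_lt_of_le (by norm_num) h.ten_le_c

/-- **the constant of (3.35)–(3.36) is positive**: `0 < O(1)·M·α₀ = c·M·α₀`. [cite: Balaban1985BackgroundPropagators, (3.35) p.396 (bookkeeping)] -/
theorem const_pos (h : ParamsPrinted η L M c α₀ α₁ a) : 0 < c * M * α₀ := mul_pos (mul_pos h.c_pos h.M_pos) h.alpha0_pos

/-- every scale `Lʲη` is positive. [cite: Balaban1985BackgroundPropagators, (3.41) p.397 (bookkeeping)] -/
theorem scaleLen_pos (h : ParamsPrinted η L M c α₀ α₁ a) (j : ℕ) : 0 < scaleLen L η j :=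
  B9Eq335RegularityClasses.scaleLen_pos h.one_le_L h.eta_pos j

/-- **«a₁ = a₀ = a > 0» propagates to every level weight of (3.24)**: `0 < a_j`, the `a_j` DEFINED BY THE PRINTED RECURSION
(`B9Eq324LevelWeights.aLevel`, row B9.Eq3.24; its `aLevel_pos` BY NAME). [cite: Balaban1985BackgroundPropagators, (3.24) p.394 (bookkeeping)] -/
theorem aLevel_pos (h : ParamsPrinted η L M c α₀ α₁ a) (j : ℕ) : 0 < B9Eq324LevelWeights.aLevel a L j :=
  B9Eq324LevelWeights.aLevel_pos h.a_pos h.one_lt_L j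

/-- … and `a_j ≤ a` (`B9Eq324LevelWeights.aLevel_le` BY NAME). [cite: Balaban1985BackgroundPropagators, (3.24) p.394 (bookkeeping)] -/
theorem aLevel_le (h : ParamsPrinted η L M c α₀ α₁ a) (j : ℕ) : B9Eq324LevelWeights.aLevel a L j ≤ a :=
  B9Eq324LevelWeights.aLevel_le h.a_pos h.one_lt_L j

end ParamsPrinted

/-! ## §1b  Two elementary letters: the covariant `η`-curl and `η`-divergence of the zero field -/

section ZeroField

variable {𝔸 : Type*} [Ring 𝔸] [Algebra ℂ 𝔸] {S : Type*} {ι : Type*}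
variable (T : ι → Equiv.Perm S) (U : ι → S → 𝔸ˣ)

/-- `D^η_U 0 = 0` on bond functions (the covariant curl (3.4) of the zero field), for ANY background. [cite: Balaban1985BackgroundPropagators, (3.4) p.391 (bookkeeping)] -/
theorem curlη_zero_field (η : ℝ) : curlη T U η (0 : ι → S → 𝔸) = 0 := by
  funext μ ν x
  simp [B9Eq39Adjoint.curlη, B9Eq39Adjoint.curl]

variable [Fintype ι] [LinearOrder ι]

/-- `D^{η*}_U 0 = 0` on plaquette functions ((3.9) of the zero function), for ANY background. [cite: Balaban1985BackgroundPropagators, (3.9) p.392 (bookkeeping)] -/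
theorem divPη_zero_field (η : ℝ) (μ : ι) (x : S) : divPη T U η (0 : ι → ι → S → 𝔸) μ x = 0 := by
  simp only [B9Eq39Adjoint.divPη, B9Eq39Adjoint.divP, Pi.zero_apply]
  simp

end ZeroField

/-! ## §2  Print's two composite classes of p. 396, by name -/

section Classes

variable {𝔸 : Type*} [NormedRing 𝔸] [NormedAlgebra ℂ 𝔸] [CompleteSpace 𝔸] {S : Type*} {ι : Type*} [Fintype ι] [LinearOrder ι]
variable (T : ι → Equiv.Perm S) (G : Subgroup 𝔸ˣ) (U : ι → S → 𝔸ˣ)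

/-- **THE CLASS (3.37) of p. 396** — verbatim: *«We assume that they have the form U′U, where U has values in G and U′ = e^{iηA′}, A′ ∈ 𝔤ᶜ.
For a given pair of positive numbers α₀, α₁ we consider the class of these configurations satisfying: U satisfies the condition (3.35), and
|A′| < α₁(Lʲη)⁻¹, |∇^η_U A′| < α₁(Lʲη)⁻² on Ω_j, j = 0, …, k; (3.37)»* — as the conjunction BY NAME of «U has values in G» (the gauge group
`G : Subgroup 𝔸ˣ` a parameter; `G = ⊤` drops the clause), the class (3.35) of `U` for the cube class `𝒬` with the constant `C = O(1)Mα₀`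
(`B9Eq335RegularityClasses.Reg335`, row B9.Eq3.35) and the (3.37) bounds on `A′` on the `Ω_j` given by the level function `lev`
(`B9Eq335RegularityClasses.Cplx337`, row B9.Eq3.37).  The pair `(U, A′)` stands for the configuration `U′U = e^{iηA′}U`
(`B9Eq39Adjoint.prodCfg`).  Hypothesis-form; nothing is asserted. [cite: Balaban1985BackgroundPropagators, (3.35) + (3.37) p.396] -/
def Class337 (η L : ℝ) (𝒬 : Set (Set S × ℕ)) (C : ℝ) (lev : S → ℕ) (α₁ : ℝ) (A' : ι → S → 𝔸) : Prop :=
  (∀ μ x, U μ x ∈ G) ∧ Reg335 T U η L 𝒬 C ∧ Cplx337 T U η L lev α₁ A'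

/-- **THE CLASS (3.38) of p. 396** — verbatim: *«U satisfies (3.35), (3.36), A′ satisfies (3.37) and |D^{η*}_U D^η_U A′| < α₁(Lʲη)⁻³ on
Ω_j, j = 0, …, k. (3.38)»* (same frame as `Class337`: «U has values in G», `U′ = e^{iηA′}`) — the conjunction BY NAME of the `G`-valuedness
clause, `B9Eq335RegularityClasses.Reg336` ((3.35)–(3.36), row B9.Eq3.35) and `B9Eq335RegularityClasses.Cplx338` ((3.37)–(3.38), row
B9.Eq3.37).  Hypothesis-form; nothing is asserted. [cite: Balaban1985BackgroundPropagators, (3.35)–(3.38) p.396] -/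
def Class338 (η L : ℝ) (𝒬 : Set (Set S × ℕ)) (C : ℝ) (lev : S → ℕ) (α₁ : ℝ) (A' : ι → S → 𝔸) : Prop :=
  (∀ μ x, U μ x ∈ G) ∧ Reg336 T U η L 𝒬 C ∧ Cplx338 T U η L lev α₁ A'

variable {T G U}

/-- the class (3.38) is contained in the class (3.37) («U satisfies (3.35), (3.36), A′ satisfies (3.37) and …»; `Reg336.reg335` BY NAME).
[cite: Balaban1985BackgroundPropagators, (3.37)–(3.38) p.396 (bookkeeping)] -/
theorem Class338.class337 {η L : ℝ} {𝒬 : Set (Set S × ℕ)} {C : ℝ} {lev : S → ℕ} {α₁ : ℝ} {A' : ι → S → 𝔸}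
    (h : Class338 T G U η L 𝒬 C lev α₁ A') : Class337 T G U η L 𝒬 C lev α₁ A' :=
  ⟨h.1, h.2.1.reg335 T U, h.2.2.1⟩

omit [Fintype ι] [LinearOrder ι] in
/-- **the zero perturbation is in the class (3.37)**: if `U` has values in `G` and satisfies (3.35), then `(U, A′ = 0)` — i.e. `U′ = 1`,
the configuration `U` itself — is in the class (3.37) for every `α₁ > 0` (`L ≥ 1`, `η > 0`; `cplx337_zero` BY NAME).
[cite: Balaban1985BackgroundPropagators, (3.37) p.396 (bookkeeping)] -/
theorem class337_zero {η L : ℝ} (hL : 1 ≤ L) (hη : 0 < η) {𝒬 : Set (Set S × ℕ)} {C : ℝ} (lev : S → ℕ) {α₁ : ℝ} (hα : 0 < α₁)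
    (hG : ∀ μ x, U μ x ∈ G) (h35 : Reg335 T U η L 𝒬 C) : Class337 T G U η L 𝒬 C lev α₁ (0 : ι → S → 𝔸) :=
  ⟨hG, h35, B9Eq335RegularityClasses.cplx337_zero T U hL hη lev hα⟩

/-- **the zero perturbation is in the class (3.38)** over every `G`-valued `U` of the class (3.35)–(3.36), for every `α₁ > 0`
(`D^{η*}_U D^η_U 0 = 0`). [cite: Balaban1985BackgroundPropagators, (3.38) p.396 (bookkeeping)] -/
theorem class338_zero {η L : ℝ} (hL : 1 ≤ L) (hη : 0 < η) {𝒬 : Set (Set S × ℕ)} {C : ℝ} (lev : S → ℕ) {α₁ : ℝ} (hα : 0 < α₁)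
    (hG : ∀ μ x, U μ x ∈ G) (h36 : Reg336 T U η L 𝒬 C) : Class338 T G U η L 𝒬 C lev α₁ (0 : ι → S → 𝔸) := by
  refine ⟨hG, h36, B9Eq335RegularityClasses.cplx337_zero T U hL hη lev hα, fun j ν x _ => ?_⟩
  rw [curlη_zero_field T U η, divPη_zero_field T U η ν x, norm_zero]
  exact mul_pos hα (inv_pos.2 (pow_pos (B9Eq335RegularityClasses.scaleLen_pos hL hη j) 3))

end Classes

/-! ## §3  THE BUNDLE OF BLOCK 05 -/

section Bundle

variable {𝔸 : Type*} [NormedRing 𝔸] [NormedAlgebra ℂ 𝔸] [CompleteSpace 𝔸] {S : Type*} {ι : Type*} [Fintype ι] [LinearOrder ι]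
variable (T : ι → Equiv.Perm S) (G : Subgroup 𝔸ˣ) (U : ι → S → 𝔸ˣ)

/-- **BLOCK 05 HYPOTHESIS BUNDLE — the standing hypotheses of [B9] Sect. A (pp. 393–396) on ONE background `U` and ONE perturbation
`U′ = e^{iηA′}`, BY NAME.**  Explicit carriers and constants: the lattice (sites `S`, directions `ι`, shifts `T : ι → Equiv.Perm S` =
«x ↦ x + ηe_μ»), the gauge group `G : Subgroup 𝔸ˣ` («U has values in G»), the background `U` on positive bonds (`U μ x = U(x, x+ηe_μ)`),
the spacing `η`, block size `L`, big-block size `M`, the cube class `𝒬` of p. 396 (pairs (□, index j); row B9.Def@396) and the level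
function `lev` of the domain sequence `{Ω_j}` («on Ω_j» = `OnOmega lev j`), the cube size factor `c` (print's «O(1) ≧ 10»), the numbers
`α₀`, `α₁` of (3.35)–(3.38), the weight `a` of (3.16) ∕ (3.24), and the perturbation potential `A′`.  Fields: `params` = the printed
ranges (§1); `valued` = «U has values in G» (p. 396, p0008.txt:L34); `reg336` = «U satisfies (3.35), (3.36)» for every cube of `𝒬` with the
constant `O(1)Mα₀ = c·M·α₀` (`B9Eq335RegularityClasses.Reg336`, row B9.Eq3.35); `cplx338` = «A′ satisfies (3.37) and (3.38)»
(`B9Eq335RegularityClasses.Cplx338`, row B9.Eq3.37) — together print's class (3.38), the STRONGEST standing class of the paper (the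
hypothesis of Sect. E and of Theorems 3.12–3.15 with Theorem 3.4's complex extension); the weaker printed standing assumptions — class
(3.35) alone (*«For the operators introduced until now we need only the condition (3.35), but later on we will have to assume (3.36)
also»*, p. 396), class (3.37) — are the projections of §4.  The operators of Sect. A ((3.10)–(3.27)) are DEFINED in the cited modules
and carry no hypothesis.  NOT a conjunct: the p. 396∕397 sentence «(3.37), (3.38) ⟹ (3.35), (3.36) with O(1)(α₀ + α₁)» (deferred by the
author to another paper, unused in [B9]; module docstring §B).  A consumer takes `(h : Hyp …)` and uses §4–§5.  Hypothesis-form;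
nothing is asserted. [cite: Balaban1985BackgroundPropagators, (3.35)–(3.38) p.396 + (3.24) p.394] -/
structure Hyp (η L M : ℝ) (𝒬 : Set (Set S × ℕ)) (lev : S → ℕ) (c α₀ α₁ a : ℝ) (A' : ι → S → 𝔸) : Prop where
  /-- the printed ranges of `η, L, M, c, α₀, α₁, a` (§1). [cite: Balaban1985BackgroundPropagators, (3.24) p.394 + p.396] -/
  params : ParamsPrinted η L M c α₀ α₁ a
  /-- «U has values in G» (p. 396, p0008.txt:L34). [cite: Balaban1985BackgroundPropagators, p.396] -/
  valued : ∀ μ x, U μ x ∈ G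
  /-- **«U satisfies (3.35), (3.36)»** with the constant `O(1)Mα₀ = c·M·α₀`, for every cube of the class `𝒬`
  (`B9Eq335RegularityClasses.Reg336` BY NAME). [cite: Balaban1985BackgroundPropagators, (3.35)–(3.36) p.396] -/
  reg336 : Reg336 T U η L 𝒬 (c * M * α₀)
  /-- **«A′ satisfies (3.37) and |D^{η*}_U D^η_U A′| < α₁(Lʲη)⁻³ on Ω_j, j = 0, …, k (3.38)»**
  (`B9Eq335RegularityClasses.Cplx338` BY NAME). [cite: Balaban1985BackgroundPropagators, (3.37)–(3.38) p.396] -/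
  cplx338 : Cplx338 T U η L lev α₁ A'

end Bundle

/-! ## §4  Kernel-checked bookkeeping out of the bundle (no statement of the paper asserted) -/

namespace Hyp

variable {𝔸 : Type*} [NormedRing 𝔸] [NormedAlgebra ℂ 𝔸] [CompleteSpace 𝔸] {S : Type*} {ι : Type*} [Fintype ι] [LinearOrder ι]
variable {T : ι → Equiv.Perm S} {G : Subgroup 𝔸ˣ} {U : ι → S → 𝔸ˣ}
variable {η L M : ℝ} {𝒬 : Set (Set S × ℕ)} {lev : S → ℕ} {c α₀ α₁ a : ℝ} {A' : ι → S → 𝔸}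

/-- the constant of (3.35)–(3.36) in the bundle is positive. [cite: Balaban1985BackgroundPropagators, (3.35) p.396 (bookkeeping)] -/
theorem const_pos (h : Hyp T G U η L M 𝒬 lev c α₀ α₁ a A') : 0 < c * M * α₀ := h.params.const_pos

/-- **class (3.35) alone** — «For the operators introduced until now we need only the condition (3.35)» (p. 396): `Reg335` out of the
bundle (`Reg336.reg335` BY NAME). [cite: Balaban1985BackgroundPropagators, (3.35) p.396 (bookkeeping)] -/
theorem reg335 (h : Hyp T G U η L M 𝒬 lev c α₀ α₁ a A') : Reg335 T U η L 𝒬 (c * M * α₀) := h.reg336.reg335 T U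

/-- the (3.37) bounds on `A′` out of the bundle. [cite: Balaban1985BackgroundPropagators, (3.37) p.396 (bookkeeping)] -/
theorem cplx337 (h : Hyp T G U η L M 𝒬 lev c α₀ α₁ a A') : Cplx337 T U η L lev α₁ A' := h.cplx338.1

/-- **print's class (3.38)** (§2) out of the bundle. [cite: Balaban1985BackgroundPropagators, (3.38) p.396 (bookkeeping)] -/
theorem class338 (h : Hyp T G U η L M 𝒬 lev c α₀ α₁ a A') : Class338 T G U η L 𝒬 (c * M * α₀) lev α₁ A' :=
  ⟨h.valued, h.reg336, h.cplx338⟩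

/-- **print's class (3.37)** (§2) out of the bundle — the hypothesis of Theorem 3.4 and of Sect. B.
[cite: Balaban1985BackgroundPropagators, (3.37) p.396 (bookkeeping)] -/
theorem class337 (h : Hyp T G U η L M 𝒬 lev c α₀ α₁ a A') : Class337 T G U η L 𝒬 (c * M * α₀) lev α₁ A' :=
  h.class338.class337

/-- (3.35)–(3.36) ON ONE CUBE of the class: the per-cube datum `Reg336Cube` at the scale `Lʲη` of the cube's index.
[cite: Balaban1985BackgroundPropagators, (3.35)–(3.36) p.396 (bookkeeping)] -/
theorem reg336Cube (h : Hyp T G U η L M 𝒬 lev c α₀ α₁ a A') {q : Set S × ℕ} (hq : q ∈ 𝒬) :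
    Reg336Cube T U η q.1 (scaleLen L η q.2) (c * M * α₀) :=
  h.reg336 q hq

/-- (3.35) ON ONE CUBE of the class. [cite: Balaban1985BackgroundPropagators, (3.35) p.396 (bookkeeping)] -/
theorem reg335Cube (h : Hyp T G U η L M 𝒬 lev c α₀ α₁ a A') {q : Set S × ℕ} (hq : q ∈ 𝒬) :
    Reg335Cube T U η q.1 (scaleLen L η q.2) (c * M * α₀) :=
  h.reg335 q hq

/-- **the p. 397 remark** («For α negative we can take Ω_j instead of Ω_j∖Ω_{j+1}»): the (3.37) bounds at the OWN level `j = lev x`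
(`cplx337_iff_own` BY NAME). [cite: Balaban1985BackgroundPropagators, (3.37) p.396, p.397 (bookkeeping)] -/
theorem cplx337Own (h : Hyp T G U η L M 𝒬 lev c α₀ α₁ a A') : Cplx337Own T U η L lev α₁ A' :=
  (B9Eq335RegularityClasses.cplx337_iff_own T U h.params.one_le_L h.params.eta_pos lev h.params.alpha1_pos.le A').1 h.cplx337

/-- … and the (3.38) bounds at the own level (`cplx338_iff_own` BY NAME). [cite: Balaban1985BackgroundPropagators, (3.38) p.396, p.397 (bookkeeping)] -/
theorem cplx338Own (h : Hyp T G U η L M 𝒬 lev c α₀ α₁ a A') : Cplx338Own T U η L lev α₁ A' :=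
  (B9Eq335RegularityClasses.cplx338_iff_own T U h.params.one_le_L h.params.eta_pos lev h.params.alpha1_pos.le A').1 h.cplx338

/-- the first printed letter of (3.37), strict, at the own scale: `‖A′_κ(x)‖ < α₁·(L^{lev x}η)⁻¹`.
[cite: Balaban1985BackgroundPropagators, (3.37) p.396 (bookkeeping)] -/
theorem norm_letter_lt (h : Hyp T G U η L M 𝒬 lev c α₀ α₁ a A') (κ : ι) (x : S) :
    ‖A' κ x‖ < α₁ * (scaleLen L η (lev x))⁻¹ :=
  h.cplx337Own.1 κ x

/-- the second printed letter of (3.37), strict, at the own scale: `‖η⁻¹(D¹_{U,μ}A′_ν)(x)‖ < α₁·((L^{lev x}η)²)⁻¹`.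
[cite: Balaban1985BackgroundPropagators, (3.37) p.396 (bookkeeping)] -/
theorem norm_covD_lt (h : Hyp T G U η L M 𝒬 lev c α₀ α₁ a A') (μ ν : ι) (x : S) :
    ‖((η : ℂ)⁻¹) • covD T U μ (A' ν) x‖ < α₁ * (scaleLen L η (lev x) ^ 2)⁻¹ :=
  h.cplx337Own.2 μ ν x

/-- the printed letter of (3.38), strict, at the own scale: `‖(D^{η*}_U D^η_U A′)_ν(x)‖ < α₁·((L^{lev x}η)³)⁻¹`.
[cite: Balaban1985BackgroundPropagators, (3.38) p.396 (bookkeeping)] -/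
theorem norm_divD_lt (h : Hyp T G U η L M 𝒬 lev c α₀ α₁ a A') (ν : ι) (x : S) :
    ‖divPη T U η (curlη T U η A') ν x‖ < α₁ * (scaleLen L η (lev x) ^ 3)⁻¹ :=
  h.cplx338Own.2 ν x

/-- **the Sect. B literal binders** (the `≤`-form hypotheses of `B9Thm34SectBUniform.thm34_Gp_uniform` &c.), read off the bundle
(`Cplx337.binders` BY NAME). [cite: Balaban1985BackgroundPropagators, (3.37) p.396, Thm 3.4 p.400 (bookkeeping)] -/
theorem binders (h : Hyp T G U η L M 𝒬 lev c α₀ α₁ a A') :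
    (∀ κ x, ‖A' κ x‖ ≤ α₁ * (scaleLen L η (lev x))⁻¹) ∧
      ∀ μ ν x, ‖((η : ℂ)⁻¹) • covD T U μ (A' ν) x‖ ≤ α₁ * (scaleLen L η (lev x) ^ 2)⁻¹ :=
  B9Eq335RegularityClasses.Cplx337.binders T U h.params.one_le_L h.params.eta_pos h.params.alpha1_pos.le h.cplx337

/-- **the bond-local datum of (3.35)–(3.36)** (`B9Eq336CurrentBound.RegularAt`, whence `|J| ≦ (1 + 10⁴(d−1)C)Cξ⁻³` there) at every bond
`⟨x, x+ηe_μ⟩` whose stencil lies in a cube of the class (`regularAt_of_reg336Cube` BY NAME).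
[cite: Balaban1985BackgroundPropagators, (3.35)–(3.36) p.396, (3.11) p.392 (bookkeeping)] -/
theorem regularAt (h : Hyp T G U η L M 𝒬 lev c α₀ α₁ a A') {q : Set S × ℕ} (hq : q ∈ 𝒬) {μ : ι} {x : S} (hx : x ∈ q.1)
    (h₁ : ∀ κ, T κ x ∈ q.1) (h₂ : ∀ ν, (T ν).symm x ∈ q.1) (h₃ : ∀ ν, T μ ((T ν).symm x) ∈ q.1) :
    RegularAt T U η (c * M * α₀) (scaleLen L η q.2) μ x :=
  B9Eq335RegularityClasses.regularAt_of_reg336Cube T U h.params.eta_pos (h.reg336 q hq) hx h₁ h₂ h₃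

/-- the level weights of (3.24) are positive under the bundle (`ParamsPrinted.aLevel_pos`).
[cite: Balaban1985BackgroundPropagators, (3.24) p.394 (bookkeeping)] -/
theorem aLevel_pos (h : Hyp T G U η L M 𝒬 lev c α₀ α₁ a A') (j : ℕ) : 0 < B9Eq324LevelWeights.aLevel a L j :=
  h.params.aLevel_pos j

/-- **monotonicity in `α₁`**: the bundle at `α₁` implies the bundle at every larger `α₁′` (both classes (3.37), (3.38) grow with `α₁`).
[cite: Balaban1985BackgroundPropagators, (3.37)–(3.38) p.396 (bookkeeping)] -/
theorem mono_alpha1 (h : Hyp T G U η L M 𝒬 lev c α₀ α₁ a A') {α₁' : ℝ} (hle : α₁ ≤ α₁') :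
    Hyp T G U η L M 𝒬 lev c α₀ α₁' a A' := by
  have hp := h.params
  refine ⟨⟨hp.eta_pos, hp.one_lt_L, hp.M_pos, hp.ten_le_c, hp.alpha0_pos, lt_of_lt_of_le hp.alpha1_pos hle, hp.a_pos⟩,
    h.valued, h.reg336, ?_, fun j ν x hjx => ?_⟩
  · exact B9Eq335RegularityClasses.Cplx337.mono T U hp.one_le_L hp.eta_pos hle h.cplx337
  · exact lt_of_lt_of_le (h.cplx338.2 j ν x hjx)
      (mul_le_mul_of_nonneg_right hle (inv_pos.2 (pow_pos (hp.scaleLen_pos j) 3)).le)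

/-- **NON-DEGENERACY, letter form**: a perturbation with ONE letter at or above the printed bound, `α₁(L^{lev x}η)⁻¹ ≤ ‖A′_κ(x)‖`, is NOT
in the bundle (the class (3.37) is a genuine constraint). [cite: Balaban1985BackgroundPropagators, (3.37) p.396 (bookkeeping)] -/
theorem _root_.Literature.MathematicalPhysics.QuantumFieldTheory.Balaban1983to89.B9Carve05SetupRegularityHyp.not_hyp_of_le_norm_letter
    (κ : ι) (x : S) (hx : α₁ * (scaleLen L η (lev x))⁻¹ ≤ ‖A' κ x‖) : ¬ Hyp T G U η L M 𝒬 lev c α₀ α₁ a A' :=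
  fun h => (not_lt.2 hx) (h.norm_letter_lt κ x)

/-- **NON-DEGENERACY, group form**: a background with ONE bond variable outside `G` is NOT in the bundle.
[cite: Balaban1985BackgroundPropagators, p.396 («U has values in G»; bookkeeping)] -/
theorem _root_.Literature.MathematicalPhysics.QuantumFieldTheory.Balaban1983to89.B9Carve05SetupRegularityHyp.not_hyp_of_not_mem
    {μ : ι} {x : S} (hx : U μ x ∉ G) : ¬ Hyp T G U η L M 𝒬 lev c α₀ α₁ a A' :=
  fun h => hx (h.valued μ x)

end Hyp

/-! ## §5  Non-vacuity, and the passage to the `B9.Backgrounds` carrier of record (`B9BackgroundsKLevelV1.bg9K`) -/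

section NonVacuity

variable {𝔸 : Type} [NormedRing 𝔸] [NormedAlgebra ℂ 𝔸] [CompleteSpace 𝔸] [NormOneClass 𝔸] {S : Type*} {ι : Type*} [Fintype ι]
  [LinearOrder ι]

/-- **NON-VACUITY**: for every admissible parameter tuple, every cube class `𝒬`, level function `lev` and gauge group `G`, the trivial
background `U ≡ 1` with the zero perturbation `A′ = 0` IS in the bundle — witness `u = 1`, `A = 0` on every cube (`U^u = 1 = e^{0}`, all
bounds `0 < Cξ⁻ⁿ`; `B9BackgroundsKLevelV1.reg336Cube_one` BY NAME) and `cplx337_zero`, `D^{η*}D^η 0 = 0`.  (Print: «for U = 1 these theorems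
are proved in [4]», Cor. 3.5 p. 407 — the trivial configuration is the regular configuration par excellence.)
[cite: Balaban1985BackgroundPropagators, (3.35)–(3.38) p.396, Cor. 3.5 p.407 (bookkeeping)] -/
theorem hyp_one_zero (T : ι → Equiv.Perm S) (G : Subgroup 𝔸ˣ) {η L M c α₀ α₁ a : ℝ} (hp : ParamsPrinted η L M c α₀ α₁ a)
    (𝒬 : Set (Set S × ℕ)) (lev : S → ℕ) :
    Hyp T G (fun _ _ => (1 : 𝔸ˣ)) η L M 𝒬 lev c α₀ α₁ a (0 : ι → S → 𝔸) := by
  refine ⟨hp, fun _ _ => G.one_mem, fun q _ => ?_, ?_, fun j ν x _ => ?_⟩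
  · exact B9BackgroundsKLevelV1.reg336Cube_one T q.1 (hp.scaleLen_pos q.2) hp.const_pos
  · exact B9Eq335RegularityClasses.cplx337_zero T _ hp.one_le_L hp.eta_pos lev hp.alpha1_pos
  · rw [curlη_zero_field T _ η, divPη_zero_field T _ η ν x, norm_zero]
    exact mul_pos hp.alpha1_pos (inv_pos.2 (pow_pos (hp.scaleLen_pos j) 3))

/-- … so the bundle is satisfiable as soon as the parameter ranges are (e.g. `η = 1∕9`, `L = 3`, `M = 24`, `c = 12`, `α₀ = α₁ = 10⁻³`,
`a = 1`). [cite: Balaban1985BackgroundPropagators, (3.35)–(3.38) p.396 (bookkeeping)] -/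
theorem hyp_nonempty (T : ι → Equiv.Perm S) (G : Subgroup 𝔸ˣ) (𝒬 : Set (Set S × ℕ)) (lev : S → ℕ) :
    ∃ (U : ι → S → 𝔸ˣ) (η L M c α₀ α₁ a : ℝ) (A' : ι → S → 𝔸), Hyp T G U η L M 𝒬 lev c α₀ α₁ a A' :=
  ⟨fun _ _ => 1, 1 / 9, 3, 24, 12, 1 / 1000, 1 / 1000, 1, 0,
    hyp_one_zero T G ⟨by norm_num, by norm_num, by norm_num, by norm_num, by norm_num, by norm_num, by norm_num⟩ 𝒬 lev⟩

end NonVacuity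

section Bridge

variable {d ℓ : ℕ} {hd : 1 ≤ d + 1} {hL : Odd (ℓ + 1) ∧ 1 < ℓ + 1} {b₀ b₁ : ℝ}
variable {𝔸 : Type} [NormedRing 𝔸] [NormedAlgebra ℂ 𝔸] [CompleteSpace 𝔸] {G : Subgroup 𝔸ˣ}

open Literature.MathematicalPhysics.QuantumFieldTheory.Balaban1983to89.B6KLevelCensusIndexV1 (KIdx kGeo)
open Literature.MathematicalPhysics.QuantumFieldTheory.Balaban1983to89.B6GlobalChartV1 (PV)
open Literature.MathematicalPhysics.QuantumFieldTheory.Balaban1983to89.B9BackgroundsKLevelV1 (CfgV1 shiftsV1 cubeClass396 levV1 bg9K)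

/-- **the member's geometric ranges are theorems**: at every k-level member `i` of the torus family of record, `η = |c_f|⁻¹ > 0`,
`L = ℓ + 1 > 1`, `M = L·M_h > 0` (the first three fields of `ParamsPrinted`). [cite: Balaban1984PropagatorsII, (2.1)–(2.2) p.224 (bookkeeping on the member's parameters)] -/
theorem member_eta_pos_one_lt_L_M_pos (i : KIdx d ℓ hd hL b₀ b₁) :
    0 < (kGeo i).eta ∧ 1 < (kGeo i).L ∧ 0 < (kGeo i).M := by
  obtain ⟨hη, -, hM⟩ := B9BackgroundsKLevelV1.eta_pos_L_one_le_M_pos i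
  refine ⟨hη, ?_, hM⟩
  show (1 : ℝ) < ((ℓ + 1 : ℕ) : ℝ)
  exact_mod_cast hL.2

/-- the printed ranges AT A MEMBER reduce to the four numerical clauses `10 ≤ c`, `0 < α₀`, `0 < α₁`, `0 < a`.
[cite: Balaban1985BackgroundPropagators, (3.24) p.394 + p.396 (bookkeeping)] -/
theorem paramsPrinted_member (i : KIdx d ℓ hd hL b₀ b₁) {c α₀ α₁ a : ℝ} (hc : 10 ≤ c) (hα₀ : 0 < α₀) (hα₁ : 0 < α₁)
    (ha : 0 < a) : ParamsPrinted (kGeo i).eta (kGeo i).L (kGeo i).M c α₀ α₁ a :=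
  have h := member_eta_pos_one_lt_L_M_pos i
  ⟨h.1, h.2.1, h.2.2, hc, hα₀, hα₁, ha⟩

variable (G)

/-- **THE BUNDLE AT A k-LEVEL MEMBER `i` OF THE TORUS FAMILY OF RECORD** — `Hyp` with the member's torus shifts (`shiftsV1`), spacing
`η = (kGeo i).eta`, `L`, `M`, the cube class `cubeClass396 i` of p. 396 and the level function `levV1 i` of its domain sequence: the
shape in which the N06 ∕ K⁷ consumers meet Sect. A (`bg9K`, `Node00.CarriersZRegPin`). Hypothesis-form. [cite: Balaban1985BackgroundPropagators, (3.35)–(3.38) p.396] -/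
def HypAt (i : KIdx d ℓ hd hL b₀ b₁) (U : CfgV1 (PV d ℓ i.m i.K hd hL) 𝔸) (c α₀ α₁ a : ℝ)
    (A' : Fin (d + 1) → Site (PV d ℓ i.m i.K hd hL) 0 → 𝔸) : Prop :=
  Hyp (shiftsV1 (PV d ℓ i.m i.K hd hL)) G U (kGeo i).eta (kGeo i).L (kGeo i).M (cubeClass396 i) (levV1 i) c α₀ α₁ a A'

variable {G}

namespace HypAt

variable {i : KIdx d ℓ hd hL b₀ b₁} {U : CfgV1 (PV d ℓ i.m i.K hd hL) 𝔸} {c α₀ α₁ a : ℝ}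
  {A' : Fin (d + 1) → Site (PV d ℓ i.m i.K hd hL) 0 → 𝔸}

/-- unfolding. [cite: Balaban1985BackgroundPropagators, (3.35)–(3.38) p.396 (bookkeeping)] -/
theorem hyp (h : HypAt G i U c α₀ α₁ a A') :
    Hyp (shiftsV1 (PV d ℓ i.m i.K hd hL)) G U (kGeo i).eta (kGeo i).L (kGeo i).M (cubeClass396 i) (levV1 i) c α₀ α₁ a A' :=
  h

/-- **the field `Reg335` of the carrier of record** out of the bundle: `(bg9K 𝔸 G i).Reg335 c α₀ U` — the hypothesis under which
`B9.Thm31Printed` … `B9.Thm311Printed` are consumed at the member. [cite: Balaban1985BackgroundPropagators, (3.35) p.396 (bookkeeping)] -/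
theorem bg9K_reg335 (h : HypAt G i U c α₀ α₁ a A') : (bg9K 𝔸 G i).Reg335 c α₀ U :=
  (B9BackgroundsKLevelV1.reg335_iff i c α₀ U).2 ⟨h.hyp.valued, h.hyp.reg335⟩

/-- **the field `Reg336`** out of the bundle (the extra hypothesis of `B9.Thm312_313Printed`, `B9.Thm315Printed`).
[cite: Balaban1985BackgroundPropagators, (3.36) p.396 (bookkeeping)] -/
theorem bg9K_reg336 (h : HypAt G i U c α₀ α₁ a A') : (bg9K 𝔸 G i).Reg336 c α₀ U :=
  (B9BackgroundsKLevelV1.reg336_iff i c α₀ U).2 ⟨h.hyp.valued, h.hyp.reg336⟩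

/-- **the field `Cplx337`** out of the bundle, at the perturbation `U′ = e^{iηA′}` (`B9Eq39Adjoint.fluct`) — the hypothesis of
`B9.Thm34Printed`'s extension clause. [cite: Balaban1985BackgroundPropagators, (3.37) p.396 (bookkeeping)] -/
theorem bg9K_cplx337 (h : HypAt G i U c α₀ α₁ a A') : (bg9K 𝔸 G i).Cplx337 α₁ U (fluct (kGeo i).eta A') :=
  (B9BackgroundsKLevelV1.cplx337_iff i α₁ U _).2 ⟨A', rfl, h.hyp.cplx337⟩

/-- **the field `Cplx338`** out of the bundle, at `U′ = e^{iηA′}`. [cite: Balaban1985BackgroundPropagators, (3.38) p.396 (bookkeeping)] -/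
theorem bg9K_cplx338 (h : HypAt G i U c α₀ α₁ a A') : (bg9K 𝔸 G i).Cplx338 α₁ U (fluct (kGeo i).eta A') :=
  (B9BackgroundsKLevelV1.cplx338_iff i α₁ U _).2 ⟨A', rfl, h.hyp.cplx338⟩

/-- the configuration the pair `(U, A′)` stands for IS the carrier's product `U′U` with `U′ = e^{iηA′}` (`B9Eq39Adjoint.prodCfg`,
«U = U′U₀» p. 390 ∕ «they have the form U′U» p. 396). [cite: Balaban1985BackgroundPropagators, p.396 (bookkeeping)] -/
theorem mul_fluct_eq_prodCfg (U : CfgV1 (PV d ℓ i.m i.K hd hL) 𝔸) (A' : Fin (d + 1) → Site (PV d ℓ i.m i.K hd hL) 0 → 𝔸) :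
    (bg9K 𝔸 G i).mul (fluct (kGeo i).eta A') U = B9Eq39Adjoint.prodCfg U (kGeo i).eta A' := by
  funext μ x
  rfl

end HypAt

/-- **CONVERSELY: the two strongest fields of the carrier of record, with the printed parameter ranges, ARE the bundle** — if
`(bg9K 𝔸 G i).Reg336 c α₀ U` and `(bg9K 𝔸 G i).Cplx338 α₁ U U′` with `10 ≤ c`, `0 < α₀`, `0 < α₁`, `0 < a`, then `U′ = e^{iηA′}` for a
potential `A′` with `HypAt G i U c α₀ α₁ a A′` (the member's `η, L, M` ranges being theorems).
[cite: Balaban1985BackgroundPropagators, (3.35)–(3.38) p.396 (bookkeeping)] -/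
theorem hypAt_of_bg9K {i : KIdx d ℓ hd hL b₀ b₁} {U U' : CfgV1 (PV d ℓ i.m i.K hd hL) 𝔸} {c α₀ α₁ a : ℝ} (hc : 10 ≤ c)
    (hα₀ : 0 < α₀) (hα₁ : 0 < α₁) (ha : 0 < a) (h36 : (bg9K 𝔸 G i).Reg336 c α₀ U) (h38 : (bg9K 𝔸 G i).Cplx338 α₁ U U') :
    ∃ A' : Fin (d + 1) → Site (PV d ℓ i.m i.K hd hL) 0 → 𝔸, U' = fluct (kGeo i).eta A' ∧ HypAt G i U c α₀ α₁ a A' := by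
  obtain ⟨hG, h36'⟩ := (B9BackgroundsKLevelV1.reg336_iff i c α₀ U).1 h36
  obtain ⟨A', hU', h38'⟩ := (B9BackgroundsKLevelV1.cplx338_iff i α₁ U U').1 h38
  exact ⟨A', hU', paramsPrinted_member i hc hα₀ hα₁ ha, hG, h36', h38'⟩

/-- NON-VACUITY AT A MEMBER (`𝔸` with `‖1‖ = 1`): `U ≡ 1`, `A′ = 0` is in the bundle of every member for every `c ≥ 10`, `α₀, α₁, a > 0`.
[cite: Balaban1985BackgroundPropagators, Cor. 3.5 p.407 («U = 1»; bookkeeping)] -/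
theorem hypAt_one_zero [NormOneClass 𝔸] (i : KIdx d ℓ hd hL b₀ b₁) {c α₀ α₁ a : ℝ} (hc : 10 ≤ c) (hα₀ : 0 < α₀)
    (hα₁ : 0 < α₁) (ha : 0 < a) :
    HypAt G i (fun _ _ => (1 : 𝔸ˣ)) c α₀ α₁ a (0 : Fin (d + 1) → Site (PV d ℓ i.m i.K hd hL) 0 → 𝔸) :=
  hyp_one_zero (shiftsV1 (PV d ℓ i.m i.K hd hL)) G (paramsPrinted_member i hc hα₀ hα₁ ha) (cubeClass396 i) (levV1 i)

end Bridge

end Literature.MathematicalPhysics.QuantumFieldTheory.Balaban1983to89.B9Carve05SetupRegularityHyp
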